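import Literature.MathematicalPhysics.QuantumManyBody.CoarseModeRayPOVM
import Literature.MathematicalPhysics.QuantumManyBody.PeriodicBoseGasLemma33
import Literature.MathematicalPhysics.QuantumManyBody.WeightedCorrector
import HarnessLib

/-!
# The coarse-mode ray POVM for one particle: `∫ ‖K_zΦ‖² dσ(z) = ‖Φ‖²`

Topic `Literature/MathematicalPhysics/QuantumManyBody`, companion of `CoarseModeRayPOVM.lean`
(definition item `defn-CoarseModeRayPOVM`, route `BECIroning` of
`AtomisticToContinuum/BoseEinsteinCondensation`). The POVM property of the coarse-mode ray
Kraus map `K_z` — `∫_{S^{2M-1}} K_z^*K_z dσ(z) = 𝟙` on Bose-symmetric functions — is, block by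
block in the coarse particle number `m`, the resolution of the identity of the SU(M) coherent
states on symmetric tensors [BengtssonZyczkowski2017, §7.5 (7.59)]; it is not proved in general in
the tree. This file **proves it for one particle** (`N = 1`, blocks `m ≤ 1`, weights `c_0 = 1`,
`c_1 = M`), which exercises every constant and convention of the definition (`symDim`, the
kernels `p_S`, `p_z`, the normalisation of `rayMeasure`):

* `integral_rayMeasure_integral_norm_sq_coarseModeRayPOVM_one`:
  `∫ (∫_{cell} |K_zΦ|²) dσ(z) = ∫_{cell} |Φ|²` for `L > 0`, `S ≠ ∅`, `Φ` continuous;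
* `lintegral_rayMeasure_lintegral_nnnorm_sq_coarseModeRayPOVM_one`: the same in `ℝ≥0∞`
  (`= 1` for a normalised one-particle state).

**Proof** (elementary, the textbook computation). By `coarseModeRayPOVM_one`,
`K_zΦ = (φ - P_Sφ) + √M ⟨ψ_z, φ⟩ ψ_z` with `φ` the one-body wave function of `Φ`,
`P_Sφ = ∑_{n∈S} a_n φ_n`, `a_n = ⟨φ_n, φ⟩` (`coarseModeRayPOVM_one_modes`,
`coarseModeRayPOVM_one_eq_fine_add_ray`). Orthonormality of the `φ_n` on the cell
(`integral_conj_planeWaveMode_mul_planeWaveMode`, from `integral_cell_cellWave_eq_zero` of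
`PeriodicBoseGasLemma33.lean`) gives `⟨φ_n, φ - P_Sφ⟩ = 0` (`n ∈ S`), `⟨φ - P_Sφ, ψ_z⟩ = 0`,
`‖ψ_z‖² = ‖z‖² = 1` and Bessel's identity `‖φ - P_Sφ‖² = ‖φ‖² - ∑|a_n|²`, whence
`‖K_zΦ‖² = ‖φ - P_Sφ‖² + M|⟨ψ_z, φ⟩|²` (`integral_norm_sq_coarseModeRayPOVM_one`); the second
moments of the record law, `∫ z_n conj(z_{n'}) dσ = δ_{nn'}/M`
(`integral_sphere_coord_mul_conj`), give `M ∫|⟨ψ_z, φ⟩|² dσ = ∑|a_n|²`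
(`integral_conj_rayAmplitude_mul_rayAmplitude`), and the two sums cancel.

Auxiliary vocabulary (all with bodies): `modeCoeff L n φ = ⟨φ_n, φ⟩`, `oneBodyOf Φ`,
`cellInner L f g = ∫_{cell} conj(f) g` with its sesquilinearity on continuous functions,
`coarsePart L S φ = P_Sφ`, `rayAmplitude L S z φ = ⟨ψ_z, φ⟩`; and `integral_cellN_one`
(`∫_{cellN 1 L} F(x₀) dX = ∫_{cell L} F`). No named facts.

## References

* [BengtssonZyczkowski2017] I. Bengtsson, K. Życzkowski, *Geometry of Quantum States*, 2nd ed.,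
  CUP 2017: §7.5 (7.59) (`N_{K,m} ∫ dΩ |⟨ψ|z⟩|² = 1`), §10.1 (10.18).
* [Lieb1973] E. H. Lieb, *The classical limit of quantum spin systems*, Comm. Math. Phys. 31
  (1973) 327–340: (2.14).
-/

noncomputable section

open MeasureTheory Metric
open scoped ENNReal NNReal ComplexConjugate

namespace Literature.MathematicalPhysics.QuantumManyBody.BoseGas

variable {L : ℝ} {S : Finset (Fin 3 → ℤ)}

/-! ### Orthonormality of the plane-wave modes on the cell -/

/-- **Orthonormality of the normalised plane waves on the cell**:
`∫_{[0,L)³} conj(φ_n) φ_{n'} = δ_{nn'}` (`L > 0`). [folklore] -/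
theorem integral_conj_planeWaveMode_mul_planeWaveMode (hL : 0 < L) (n n' : Fin 3 → ℤ) :
    ∫ x in cell L, conj (planeWaveMode L n x) * planeWaveMode L n' x = if n = n' then 1 else 0 := by
  have hL3 : (0 : ℝ) < L ^ 3 := by positivity
  have hpt : ∀ x : Space, conj (planeWaveMode L n x) * planeWaveMode L n' x =
      ((L ^ 3)⁻¹ : ℂ) * cellWave L (n' - n) x := by
    intro x
    rw [planeWaveMode_eq, planeWaveMode_eq, map_mul, conj_cellWave, sub_eq_add_neg, add_comm,
      cellWave_add_index]
    have hs : conj (((Real.sqrt (L ^ 3))⁻¹ : ℂ)) = ((Real.sqrt (L ^ 3))⁻¹ : ℂ) := by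
      rw [map_inv₀, Complex.conj_ofReal]
    rw [hs]
    have hsq : ((Real.sqrt (L ^ 3))⁻¹ : ℂ) * ((Real.sqrt (L ^ 3))⁻¹ : ℂ) = ((L ^ 3)⁻¹ : ℂ) := by
      rw [← mul_inv, ← Complex.ofReal_mul, Real.mul_self_sqrt hL3.le]
      push_cast
      ring
    rw [← hsq]
    ring
  simp_rw [hpt]
  rw [integral_const_mul]
  by_cases h : n = n'
  · subst h
    rw [if_pos rfl, sub_self, integral_cell_cellWave_zero hL]
    have h2 : (L : ℂ) ≠ 0 := by exact_mod_cast hL.ne'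
    field_simp
  · rw [if_neg h, integral_cell_cellWave_eq_zero hL (sub_ne_zero.mpr (Ne.symm h)), mul_zero]

/-! ### One particle: functions on `Config 1` are functions on `ℝ³` -/

/-- For one particle, substituting the only coordinate gives the constant configuration.
[folklore] -/
theorem update_fin_one (X : Config 1) (y : Space) : Function.update X 0 y = fun _ => y :=
  Function.update_eq_const_of_subsingleton 0 y X

/-- A one-particle configuration is determined by its only coordinate. [folklore] -/
theorem config_one_eq (X : Config 1) : X = fun _ => X 0 := by
  funext i
  rw [Subsingleton.elim i 0]

/-- **Integrals over `cell^1` are integrals over the cell**: `∫_{cellN 1 L} F(x₀) dX = ∫_{cell L} F`.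
[folklore] -/
theorem integral_cellN_one {G : Type*} [NormedAddCommGroup G] [NormedSpace ℝ G] (L : ℝ)
    (F : Space → G) : ∫ X in cellN 1 L, F (X 0) = ∫ x in cell L, F x := by
  have hmp := volume_preserving_funUnique (Fin 1) Space
  have hpre : cellN 1 L = (MeasurableEquiv.funUnique (Fin 1) Space) ⁻¹' cell L := by
    ext X
    simp only [cellN, Set.mem_setOf_eq, Set.mem_preimage, MeasurableEquiv.funUnique_apply]
    constructor
    · intro h; exact h 0
    · intro h i; rw [Subsingleton.elim i 0]; exact h
  rw [hpre]
  exact hmp.setIntegral_preimage_emb (MeasurableEquiv.measurableEmbedding _) F (cell L)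

/-! ### The mode coefficients and the decomposition of `K_zΦ` for one particle -/

/-- The coefficient `a_n(φ) = ⟨φ_n, φ⟩ = ∫_{[0,L)³} conj(φ_n) φ` of a one-body function in the
normalised plane wave `φ_n`. [folklore] -/
def modeCoeff (L : ℝ) (n : Fin 3 → ℤ) (φ : Space → ℂ) : ℂ :=
  ∫ y in cell L, conj (planeWaveMode L n y) * φ y

/-- The one-body wave function of a one-particle configuration function. [folklore] -/
def oneBodyOf (Φ : Config 1 → ℂ) (y : Space) : ℂ := Φ fun _ => y

/-- `Φ(X) = φ(x₀)` for one particle. [folklore] -/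
theorem oneBodyOf_apply_zero (Φ : Config 1 → ℂ) (X : Config 1) : oneBodyOf Φ (X 0) = Φ X := by
  rw [oneBodyOf, ← config_one_eq X]

/-- The one-body wave function is continuous if `Φ` is. [folklore] -/
theorem continuous_oneBodyOf {Φ : Config 1 → ℂ} (hΦ : Continuous Φ) : Continuous (oneBodyOf Φ) :=
  hΦ.comp (continuous_pi fun _ => continuous_id)

/-- `y ↦ conj(φ_n(y)) φ(y)` is integrable on the cell for continuous `φ`. [folklore] -/
theorem integrableOn_conj_planeWaveMode_mul (L : ℝ) (n : Fin 3 → ℤ) {φ : Space → ℂ}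
    (hφ : Continuous φ) : IntegrableOn (fun y => conj (planeWaveMode L n y) * φ y) (cell L) volume :=
  integrableOn_cell ((Complex.continuous_conj.comp (continuous_planeWaveMode L n)).mul hφ)

/-- **`P_S` on one particle**: `∫ p_S(x, y) φ(y) dy = ∑_{n∈S} a_n(φ) φ_n(x)`. [folklore] -/
theorem integral_coarseKernel_mul (L : ℝ) (S : Finset (Fin 3 → ℤ)) {φ : Space → ℂ}
    (hφ : Continuous φ) (x : Space) :
    ∫ y in cell L, coarseKernel L S x y * φ y = ∑ n ∈ S, modeCoeff L n φ * planeWaveMode L n x := by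
  have hpt : ∀ y, coarseKernel L S x y * φ y =
      ∑ n ∈ S, planeWaveMode L n x * (conj (planeWaveMode L n y) * φ y) := by
    intro y
    rw [coarseKernel, Finset.sum_mul]
    exact Finset.sum_congr rfl fun n _ => by ring
  simp_rw [hpt]
  rw [integral_finsetSum _ fun n _ => (integrableOn_conj_planeWaveMode_mul L n hφ).const_mul _]
  refine Finset.sum_congr rfl fun n _ => ?_
  rw [integral_const_mul, modeCoeff, mul_comm]

/-- The **ray amplitude** `b_z(φ) = ⟨ψ_z, φ⟩ = ∑_n conj(z_n) a_n(φ)`. [folklore] -/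
theorem integral_conj_rayMode_mul (L : ℝ) (S : Finset (Fin 3 → ℤ)) (z : EuclideanSpace ℂ ↥S)
    {φ : Space → ℂ} (hφ : Continuous φ) :
    ∫ y in cell L, conj (rayMode L S z y) * φ y = ∑ n : ↥S, conj (z n) * modeCoeff L n φ := by
  have hpt : ∀ y, conj (rayMode L S z y) * φ y =
      ∑ n : ↥S, conj (z n) * (conj (planeWaveMode L n y) * φ y) := by
    intro y
    rw [rayMode, map_sum, Finset.sum_mul]
    exact Finset.sum_congr rfl fun n _ => by rw [map_mul]; ring
  simp_rw [hpt]
  rw [integral_finsetSum _ fun (n : ↥S) _ =>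
    (integrableOn_conj_planeWaveMode_mul L (n : Fin 3 → ℤ) hφ).const_mul (conj (z n))]
  refine Finset.sum_congr rfl fun n _ => ?_
  rw [integral_const_mul, modeCoeff]

/-- **`P_z` on one particle**: `∫ p_z(x, y) φ(y) dy = b_z(φ) ψ_z(x)`. [folklore] -/
theorem integral_rayKernel_mul (L : ℝ) (S : Finset (Fin 3 → ℤ)) (z : EuclideanSpace ℂ ↥S)
    {φ : Space → ℂ} (hφ : Continuous φ) (x : Space) :
    ∫ y in cell L, rayKernel L S z x y * φ y =
      (∑ n : ↥S, conj (z n) * modeCoeff L n φ) * rayMode L S z x := by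
  simp only [rayKernel, mul_assoc]
  rw [integral_const_mul, integral_conj_rayMode_mul L S z hφ, mul_comm]

/-- **The Kraus map on one particle, resolved in modes**:
`K_zΦ(x) = (φ(x) - ∑_{n∈S} a_n φ_n(x)) + √M b_z ψ_z(x)` with `a_n = ⟨φ_n, φ⟩`, `b_z = ⟨ψ_z, φ⟩`.
[cite: BengtssonZyczkowski2017, §7.5 (7.59)] -/
theorem coarseModeRayPOVM_one_modes (L : ℝ) (S : Finset (Fin 3 → ℤ)) (z : EuclideanSpace ℂ ↥S)
    {Φ : Config 1 → ℂ} (hΦ : Continuous Φ) (X : Config 1) :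
    coarseModeRayPOVM L S z Φ X =
      (oneBodyOf Φ (X 0) - ∑ n ∈ S, modeCoeff L n (oneBodyOf Φ) * planeWaveMode L n (X 0)) +
        (Real.sqrt S.card : ℂ) *
          ((∑ n : ↥S, conj (z n) * modeCoeff L n (oneBodyOf Φ)) * rayMode L S z (X 0)) := by
  have hup : ∀ y, Φ (Function.update X 0 y) = oneBodyOf Φ y := fun y => by
    rw [update_fin_one]; rfl
  rw [coarseModeRayPOVM_one]
  simp_rw [hup]
  rw [integral_coarseKernel_mul L S (continuous_oneBodyOf hΦ),
    integral_rayKernel_mul L S z (continuous_oneBodyOf hΦ), oneBodyOf_apply_zero]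

/-! ### The `L²([0,L)³)` pairing of continuous functions -/

/-- The `L²` pairing on the cell, `⟪f, g⟫_L = ∫_{[0,L)³} conj(f) g` (complex Bochner integral).
[folklore] -/
def cellInner (L : ℝ) (f g : Space → ℂ) : ℂ :=
  ∫ x in cell L, conj (f x) * g x

/-- Integrability of `conj(f) g` on the cell for continuous `f, g`. [folklore] -/
theorem integrableOn_conj_mul {f g : Space → ℂ} (hf : Continuous f) (hg : Continuous g) (L : ℝ) :
    IntegrableOn (fun x => conj (f x) * g x) (cell L) volume :=
  integrableOn_cell ((Complex.continuous_conj.comp hf).mul hg)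

/-- Hermitian symmetry: `⟪g, f⟫ = conj ⟪f, g⟫`. [folklore] -/
theorem cellInner_conj_symm (L : ℝ) (f g : Space → ℂ) : cellInner L g f = conj (cellInner L f g) := by
  rw [cellInner, cellInner, ← integral_conj]
  refine integral_congr_ae (Filter.Eventually.of_forall fun x => ?_)
  simp only [map_mul, Complex.conj_conj, mul_comm]

/-- `⟪f, f⟫ = ‖f‖²_{L²(cell)}` (as a complex number). [folklore] -/
theorem cellInner_self_eq_ofReal (L : ℝ) (f : Space → ℂ) :
    cellInner L f f = ((∫ x in cell L, ‖f x‖ ^ 2 : ℝ) : ℂ) := by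
  rw [cellInner, ← integral_complex_ofReal]
  refine integral_congr_ae (Filter.Eventually.of_forall fun x => ?_)
  show conj (f x) * f x = ((‖f x‖ ^ 2 : ℝ) : ℂ)
  rw [Complex.conj_mul', Complex.ofReal_pow]

/-- Additivity in the second slot. [folklore] -/
theorem cellInner_add_right {f g h : Space → ℂ} (hf : Continuous f) (hg : Continuous g)
    (hh : Continuous h) (L : ℝ) : cellInner L f (g + h) = cellInner L f g + cellInner L f h := by
  simp only [cellInner, Pi.add_apply, mul_add]
  exact integral_add (integrableOn_conj_mul hf hg L) (integrableOn_conj_mul hf hh L)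

/-- Subtraction in the second slot. [folklore] -/
theorem cellInner_sub_right {f g h : Space → ℂ} (hf : Continuous f) (hg : Continuous g)
    (hh : Continuous h) (L : ℝ) : cellInner L f (g - h) = cellInner L f g - cellInner L f h := by
  simp only [cellInner, Pi.sub_apply, mul_sub]
  exact integral_sub (integrableOn_conj_mul hf hg L) (integrableOn_conj_mul hf hh L)

/-- Subtraction in the first slot. [folklore] -/
theorem cellInner_sub_left {f g h : Space → ℂ} (hf : Continuous f) (hg : Continuous g)
    (hh : Continuous h) (L : ℝ) : cellInner L (f - g) h = cellInner L f h - cellInner L g h := by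
  simp only [cellInner, Pi.sub_apply, map_sub, sub_mul]
  exact integral_sub (integrableOn_conj_mul hf hh L) (integrableOn_conj_mul hg hh L)

/-- Scalars in the second slot: `⟪f, c g⟫ = c ⟪f, g⟫`. [folklore] -/
theorem cellInner_const_mul_right (L : ℝ) (f g : Space → ℂ) (c : ℂ) :
    cellInner L f (fun x => c * g x) = c * cellInner L f g := by
  simp only [cellInner]
  rw [← integral_const_mul]
  refine integral_congr_ae (Filter.Eventually.of_forall fun x => ?_)
  ring

/-- Finite linear combinations in the second slot: `⟪f, ∑ᵢ cᵢ gᵢ⟫ = ∑ᵢ cᵢ ⟪f, gᵢ⟫`. [folklore] -/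
theorem cellInner_sum_right {ι : Type*} (t : Finset ι) {f : Space → ℂ} (hf : Continuous f)
    {g : ι → Space → ℂ} (hg : ∀ i, Continuous (g i)) (c : ι → ℂ) (L : ℝ) :
    cellInner L f (fun x => ∑ i ∈ t, c i * g i x) = ∑ i ∈ t, c i * cellInner L f (g i) := by
  simp only [cellInner, Finset.mul_sum]
  have hpt : ∀ x, ∑ i ∈ t, conj (f x) * (c i * g i x) = ∑ i ∈ t, c i * (conj (f x) * g i x) :=
    fun x => Finset.sum_congr rfl fun i _ => by ring
  simp_rw [hpt]
  rw [integral_finsetSum _ fun i _ => (integrableOn_conj_mul hf (hg i) L).const_mul _]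
  exact Finset.sum_congr rfl fun i _ => integral_const_mul _ _

/-- Finite linear combinations in the first slot: `⟪∑ᵢ cᵢ gᵢ, f⟫ = ∑ᵢ conj(cᵢ) ⟪gᵢ, f⟫`. [folklore] -/
theorem cellInner_sum_left {ι : Type*} (t : Finset ι) {f : Space → ℂ} (hf : Continuous f)
    {g : ι → Space → ℂ} (hg : ∀ i, Continuous (g i)) (c : ι → ℂ) (L : ℝ) :
    cellInner L (fun x => ∑ i ∈ t, c i * g i x) f = ∑ i ∈ t, conj (c i) * cellInner L (g i) f := by
  rw [cellInner_conj_symm, cellInner_sum_right t hf hg c L, map_sum]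
  exact Finset.sum_congr rfl fun i _ => by rw [map_mul, ← cellInner_conj_symm]

/-- Orthonormality in pairing form: `⟪φ_n, φ_{n'}⟫ = δ_{nn'}`. [folklore] -/
theorem cellInner_planeWaveMode (hL : 0 < L) (n n' : Fin 3 → ℤ) :
    cellInner L (planeWaveMode L n) (planeWaveMode L n') = if n = n' then 1 else 0 :=
  integral_conj_planeWaveMode_mul_planeWaveMode hL n n'

/-- `⟪φ_n, φ⟫ = a_n(φ)`. [folklore] -/
theorem cellInner_planeWaveMode_left (L : ℝ) (n : Fin 3 → ℤ) (φ : Space → ℂ) :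
    cellInner L (planeWaveMode L n) φ = modeCoeff L n φ := rfl

/-- Additivity in the first slot. [folklore] -/
theorem cellInner_add_left {f g h : Space → ℂ} (hf : Continuous f) (hg : Continuous g)
    (hh : Continuous h) (L : ℝ) : cellInner L (f + g) h = cellInner L f h + cellInner L g h := by
  simp only [cellInner, Pi.add_apply, map_add, add_mul]
  exact integral_add (integrableOn_conj_mul hf hh L) (integrableOn_conj_mul hg hh L)

/-- Scalars in the first slot: `⟪c f, g⟫ = conj(c) ⟪f, g⟫`. [folklore] -/
theorem cellInner_const_mul_left (L : ℝ) (f g : Space → ℂ) (c : ℂ) :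
    cellInner L (fun x => c * f x) g = conj c * cellInner L f g := by
  simp only [cellInner, map_mul]
  rw [← integral_const_mul]
  refine integral_congr_ae (Filter.Eventually.of_forall fun x => ?_)
  ring

/-! ### The coarse part, its orthogonality relations, and `‖K_zφ‖²` -/

/-- The coarse part `P_Sφ = ∑_{n∈S} a_n(φ) φ_n` of a one-body function. [folklore] -/
def coarsePart (L : ℝ) (S : Finset (Fin 3 → ℤ)) (φ : Space → ℂ) (x : Space) : ℂ :=
  ∑ n ∈ S, modeCoeff L n φ * planeWaveMode L n x

/-- The ray amplitude `b_z(φ) = ⟨ψ_z, φ⟩ = ∑_n conj(z_n) a_n(φ)`. [folklore] -/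
def rayAmplitude (L : ℝ) (S : Finset (Fin 3 → ℤ)) (z : EuclideanSpace ℂ ↥S) (φ : Space → ℂ) : ℂ :=
  ∑ n : ↥S, conj (z n) * modeCoeff L n φ

/-- The coarse part is continuous. [folklore] -/
theorem continuous_coarsePart (L : ℝ) (S : Finset (Fin 3 → ℤ)) (φ : Space → ℂ) :
    Continuous (coarsePart L S φ) := by
  unfold coarsePart
  exact continuous_finsetSum _ fun n _ => continuous_const.mul (continuous_planeWaveMode L n)

/-- `⟪φ_n, P_Sφ⟫ = a_n(φ)` for `n ∈ S` (and `0` otherwise). [folklore] -/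
theorem cellInner_planeWaveMode_coarsePart (hL : 0 < L) (S : Finset (Fin 3 → ℤ)) (φ : Space → ℂ)
    (n : Fin 3 → ℤ) :
    cellInner L (planeWaveMode L n) (coarsePart L S φ) = if n ∈ S then modeCoeff L n φ else 0 := by
  unfold coarsePart
  rw [cellInner_sum_right S (continuous_planeWaveMode L n) (fun n' => continuous_planeWaveMode L n')]
  simp only [cellInner_planeWaveMode hL, mul_ite, mul_one, mul_zero]
  exact Finset.sum_ite_eq S n fun n' => modeCoeff L n' φ

/-- **The fine part is orthogonal to the coarse modes**: `⟪φ_n, φ - P_Sφ⟫ = 0`, `n ∈ S`. [folklore] -/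
theorem cellInner_planeWaveMode_sub_coarsePart (hL : 0 < L) {S : Finset (Fin 3 → ℤ)}
    {φ : Space → ℂ} (hφ : Continuous φ) {n : Fin 3 → ℤ} (hn : n ∈ S) :
    cellInner L (planeWaveMode L n) (φ - coarsePart L S φ) = 0 := by
  rw [cellInner_sub_right (continuous_planeWaveMode L n) hφ (continuous_coarsePart L S φ),
    cellInner_planeWaveMode_coarsePart hL, if_pos hn, cellInner_planeWaveMode_left, sub_self]

/-- **The fine part is orthogonal to every ray**: `⟪φ - P_Sφ, ψ_z⟫ = 0`. [folklore] -/
theorem cellInner_sub_coarsePart_rayMode (hL : 0 < L) (S : Finset (Fin 3 → ℤ))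
    (z : EuclideanSpace ℂ ↥S) {φ : Space → ℂ} (hφ : Continuous φ) :
    cellInner L (φ - coarsePart L S φ) (rayMode L S z) = 0 := by
  have hq : Continuous (φ - coarsePart L S φ) := hφ.sub (continuous_coarsePart L S φ)
  rw [show rayMode L S z = fun x => ∑ n : ↥S, z n * planeWaveMode L (n : Fin 3 → ℤ) x from rfl,
    cellInner_sum_right Finset.univ hq (fun n : ↥S => continuous_planeWaveMode L (n : Fin 3 → ℤ))]
  refine Finset.sum_eq_zero fun n _ => ?_
  rw [cellInner_conj_symm, cellInner_planeWaveMode_sub_coarsePart hL hφ n.2, map_zero, mul_zero]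

/-- `⟪ψ_z, φ_{n'}⟫ = conj(z_{n'})` for `n' ∈ S`. [folklore] -/
theorem cellInner_rayMode_planeWaveMode (hL : 0 < L) (S : Finset (Fin 3 → ℤ))
    (z : EuclideanSpace ℂ ↥S) (n' : ↥S) :
    cellInner L (rayMode L S z) (planeWaveMode L n') = conj (z n') := by
  rw [show rayMode L S z = fun x => ∑ n : ↥S, z n * planeWaveMode L (n : Fin 3 → ℤ) x from rfl,
    cellInner_sum_left Finset.univ (continuous_planeWaveMode L _)
      (fun n : ↥S => continuous_planeWaveMode L (n : Fin 3 → ℤ))]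
  simp only [cellInner_planeWaveMode hL, Subtype.coe_inj, mul_ite, mul_one, mul_zero]
  rw [Finset.sum_ite_eq' Finset.univ n' fun n => conj (z n), if_pos (Finset.mem_univ _)]

/-- **`‖ψ_z‖² = ‖z‖²`**: `⟪ψ_z, ψ_z⟫ = ∑_n |z_n|²`. [folklore] -/
theorem cellInner_rayMode_self (hL : 0 < L) (S : Finset (Fin 3 → ℤ)) (z : EuclideanSpace ℂ ↥S) :
    cellInner L (rayMode L S z) (rayMode L S z) = ∑ n : ↥S, ((‖z n‖ ^ 2 : ℝ) : ℂ) := by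
  show cellInner L (rayMode L S z) (fun x => ∑ n : ↥S, z n * planeWaveMode L (n : Fin 3 → ℤ) x) = _
  rw [cellInner_sum_right Finset.univ (continuous_rayMode L S z)
    (fun n : ↥S => continuous_planeWaveMode L (n : Fin 3 → ℤ))]
  refine Finset.sum_congr rfl fun n _ => ?_
  rw [cellInner_rayMode_planeWaveMode hL, Complex.mul_conj, Complex.normSq_eq_norm_sq]

/-- **Bessel/Pythagoras for the fine part**: `‖φ - P_Sφ‖² = ‖φ‖² - ∑_{n∈S} |a_n|²`. [folklore] -/
theorem cellInner_sub_coarsePart_self (hL : 0 < L) (S : Finset (Fin 3 → ℤ)) {φ : Space → ℂ}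
    (hφ : Continuous φ) :
    cellInner L (φ - coarsePart L S φ) (φ - coarsePart L S φ) =
      cellInner L φ φ - ∑ n ∈ S, conj (modeCoeff L n φ) * modeCoeff L n φ := by
  have hP := continuous_coarsePart L S φ
  have h1 : cellInner L φ (coarsePart L S φ) = ∑ n ∈ S, modeCoeff L n φ * conj (modeCoeff L n φ) := by
    unfold coarsePart
    rw [cellInner_sum_right S hφ (fun n => continuous_planeWaveMode L n)]
    refine Finset.sum_congr rfl fun n _ => ?_
    rw [cellInner_conj_symm, cellInner_planeWaveMode_left]
  have h2 : cellInner L (coarsePart L S φ) φ = ∑ n ∈ S, conj (modeCoeff L n φ) * modeCoeff L n φ := by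
    unfold coarsePart
    rw [cellInner_sum_left S hφ (fun n => continuous_planeWaveMode L n)]
    rfl
  have h3 : cellInner L (coarsePart L S φ) (coarsePart L S φ) =
      ∑ n ∈ S, conj (modeCoeff L n φ) * modeCoeff L n φ := by
    show cellInner L (fun x => ∑ n ∈ S, modeCoeff L n φ * planeWaveMode L n x) (coarsePart L S φ) = _
    rw [cellInner_sum_left S hP (fun n => continuous_planeWaveMode L n)]
    refine Finset.sum_congr rfl fun n hn => ?_
    rw [cellInner_planeWaveMode_coarsePart hL, if_pos hn]
  rw [cellInner_sub_left hφ hP (hφ.sub hP), cellInner_sub_right hφ hφ hP, cellInner_sub_right hP hφ hP,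
    h1, h2, h3]
  have h4 : ∑ n ∈ S, modeCoeff L n φ * conj (modeCoeff L n φ) =
      ∑ n ∈ S, conj (modeCoeff L n φ) * modeCoeff L n φ :=
    Finset.sum_congr rfl fun n _ => mul_comm _ _
  rw [h4]
  ring

/-- **The norm of the conditional one-body state**: for `K = q + c ψ_z` with `q = φ - P_Sφ`,
`⟪K, K⟫ = ⟪q, q⟫ + |c|² ⟪ψ_z, ψ_z⟫` (the cross terms vanish). [folklore] -/
theorem cellInner_fine_add_ray_self (hL : 0 < L) (S : Finset (Fin 3 → ℤ)) (z : EuclideanSpace ℂ ↥S)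
    {φ : Space → ℂ} (hφ : Continuous φ) (c : ℂ) :
    cellInner L (fun x => (φ - coarsePart L S φ) x + c * rayMode L S z x)
        (fun x => (φ - coarsePart L S φ) x + c * rayMode L S z x) =
      cellInner L (φ - coarsePart L S φ) (φ - coarsePart L S φ) +
        conj c * c * cellInner L (rayMode L S z) (rayMode L S z) := by
  have hq : Continuous (φ - coarsePart L S φ) := hφ.sub (continuous_coarsePart L S φ)
  have hψ : Continuous (rayMode L S z) := continuous_rayMode L S z
  have hcψ : Continuous fun x => c * rayMode L S z x := continuous_const.mul hψ
  have hsum : (fun x => (φ - coarsePart L S φ) x + c * rayMode L S z x) =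
      (φ - coarsePart L S φ) + fun x => c * rayMode L S z x := rfl
  rw [hsum, cellInner_add_left hq hcψ (hq.add hcψ), cellInner_add_right hq hq hcψ,
    cellInner_add_right hcψ hq hcψ, cellInner_const_mul_right, cellInner_const_mul_left,
    cellInner_const_mul_left, cellInner_const_mul_right, cellInner_sub_coarsePart_rayMode hL S z hφ,
    cellInner_conj_symm L (φ - coarsePart L S φ) (rayMode L S z),
    cellInner_sub_coarsePart_rayMode hL S z hφ]
  simp only [mul_zero, add_zero, map_zero, zero_add]
  ring

/-! ### The weight of a record: `‖K_zΦ‖² = ‖φ - P_Sφ‖² + M |b_z|²` -/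

/-- The Kraus map on one particle as a one-body function: `K_zΦ(X) = (q + √M b_z ψ_z)(x₀)`,
`q = φ - P_Sφ`. [cite: BengtssonZyczkowski2017, §7.5 (7.59)] -/
theorem coarseModeRayPOVM_one_eq_fine_add_ray (L : ℝ) (S : Finset (Fin 3 → ℤ))
    (z : EuclideanSpace ℂ ↥S) {Φ : Config 1 → ℂ} (hΦ : Continuous Φ) (X : Config 1) :
    coarseModeRayPOVM L S z Φ X =
      (oneBodyOf Φ - coarsePart L S (oneBodyOf Φ)) (X 0) +
        ((Real.sqrt S.card : ℂ) * rayAmplitude L S z (oneBodyOf Φ)) * rayMode L S z (X 0) := by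
  rw [coarseModeRayPOVM_one_modes L S z hΦ X, Pi.sub_apply, coarsePart, rayAmplitude, mul_assoc]

/-- **The weight of the record `z` on one particle**:
`∫_{cell} |K_zΦ|² = ‖φ - P_Sφ‖² + M |b_z|²` for `z` on the unit sphere (as complex numbers:
`⟪q, q⟫ + M conj(b_z) b_z`). [cite: BengtssonZyczkowski2017, §7.5 (7.59)] -/
theorem integral_norm_sq_coarseModeRayPOVM_one (hL : 0 < L) (S : Finset (Fin 3 → ℤ))
    (z : ↥(sphere (0 : EuclideanSpace ℂ ↥S) 1)) {Φ : Config 1 → ℂ} (hΦ : Continuous Φ) :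
    ((∫ X in cellN 1 L, ‖coarseModeRayPOVM L S (z : EuclideanSpace ℂ ↥S) Φ X‖ ^ 2 : ℝ) : ℂ) =
      cellInner L (oneBodyOf Φ - coarsePart L S (oneBodyOf Φ))
          (oneBodyOf Φ - coarsePart L S (oneBodyOf Φ)) +
        (S.card : ℂ) * (conj (rayAmplitude L S (z : EuclideanSpace ℂ ↥S) (oneBodyOf Φ)) *
          rayAmplitude L S (z : EuclideanSpace ℂ ↥S) (oneBodyOf Φ)) := by
  set φ := oneBodyOf Φ with hφdef
  have hφ : Continuous φ := continuous_oneBodyOf hΦ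
  set c : ℂ := (Real.sqrt S.card : ℂ) * rayAmplitude L S (z : EuclideanSpace ℂ ↥S) φ with hc
  set K : Space → ℂ := fun x => (φ - coarsePart L S φ) x + c * rayMode L S (z : EuclideanSpace ℂ ↥S) x
    with hK
  have hpt : ∀ X : Config 1, coarseModeRayPOVM L S (z : EuclideanSpace ℂ ↥S) Φ X = K (X 0) :=
    fun X => coarseModeRayPOVM_one_eq_fine_add_ray L S _ hΦ X
  have h1 : (∫ X in cellN 1 L, ‖coarseModeRayPOVM L S (z : EuclideanSpace ℂ ↥S) Φ X‖ ^ 2) =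
      ∫ x in cell L, ‖K x‖ ^ 2 := by
    rw [← integral_cellN_one L (fun x => ‖K x‖ ^ 2)]
    exact integral_congr_ae (Filter.Eventually.of_forall fun X => by simp only [hpt])
  rw [h1, ← cellInner_self_eq_ofReal, hK, cellInner_fine_add_ray_self hL S _ hφ c,
    cellInner_rayMode_self hL]
  have hsph : ∑ n : ↥S, (((‖(z : EuclideanSpace ℂ ↥S) n‖ ^ 2 : ℝ)) : ℂ) = 1 := by
    have h := congrArg (fun r : ℝ => (r : ℂ)) (sum_norm_sq_sphere_coord z)
    simp only [Complex.ofReal_sum, Complex.ofReal_one] at h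
    exact h
  have hM : (Real.sqrt S.card : ℂ) * (Real.sqrt S.card : ℂ) = (S.card : ℂ) := by
    rw [← Complex.ofReal_mul, Real.mul_self_sqrt (Nat.cast_nonneg _), Complex.ofReal_natCast]
  rw [hsph, mul_one, hc, map_mul, Complex.conj_ofReal, ← hM]
  ring

/-! ### Averaging over the records -/

/-- **The sphere average of `|b_z|²`**: `∫ |⟨ψ_z, φ⟩|² dσ(z) = M⁻¹ ∑_{n∈S} |a_n|²` — the second
moments `∫ z_n conj(z_{n'}) dσ = δ_{nn'}/M` of the record law. [cite: BengtssonZyczkowski2017, §7.5 (7.59)] -/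
theorem integral_conj_rayAmplitude_mul_rayAmplitude (hS : S.Nonempty) (L : ℝ) (φ : Space → ℂ) :
    ∫ z, conj (rayAmplitude L S (z : EuclideanSpace ℂ ↥S) φ) *
        rayAmplitude L S (z : EuclideanSpace ℂ ↥S) φ ∂rayMeasure S =
      ((S.card : ℂ))⁻¹ * ∑ n : ↥S, conj (modeCoeff L n φ) * modeCoeff L n φ := by
  have hexp : ∀ z : ↥(sphere (0 : EuclideanSpace ℂ ↥S) 1),
      conj (rayAmplitude L S (z : EuclideanSpace ℂ ↥S) φ) * rayAmplitude L S (z : EuclideanSpace ℂ ↥S) φ =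
        ∑ n : ↥S, ∑ n' : ↥S, (conj (modeCoeff L n φ) * modeCoeff L n' φ) *
          ((z : EuclideanSpace ℂ ↥S) n * conj ((z : EuclideanSpace ℂ ↥S) n')) := by
    intro z
    rw [rayAmplitude, map_sum, Finset.sum_mul]
    refine Finset.sum_congr rfl fun n _ => ?_
    rw [Finset.mul_sum]
    refine Finset.sum_congr rfl fun n' _ => ?_
    simp only [map_mul, Complex.conj_conj]
    ring
  have hint : ∀ n n' : ↥S, Integrable (fun z : ↥(sphere (0 : EuclideanSpace ℂ ↥S) 1) =>
      (conj (modeCoeff L n φ) * modeCoeff L n' φ) *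
        ((z : EuclideanSpace ℂ ↥S) n * conj ((z : EuclideanSpace ℂ ↥S) n'))) (rayMeasure S) := by
    intro n n'
    refine integrable_rayMeasure_of_norm_le (continuous_const.mul ((continuous_sphere_coord n).mul
      (Complex.continuous_conj.comp (continuous_sphere_coord n'))))
      (C := ‖conj (modeCoeff L n φ) * modeCoeff L n' φ‖) fun z => ?_
    rw [norm_mul]
    refine mul_le_of_le_one_right (norm_nonneg _) ?_
    rw [norm_mul, Complex.norm_conj]
    exact mul_le_one₀ (norm_sphere_coord_le_one z n) (norm_nonneg _) (norm_sphere_coord_le_one z n')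
  simp_rw [hexp]
  rw [integral_finsetSum _ fun n _ => integrable_finsetSum _ fun n' _ => hint n n']
  simp_rw [integral_finsetSum _ fun n' _ => hint _ n', integral_const_mul,
    integral_sphere_coord_mul_conj hS]
  simp only [mul_ite, mul_zero, Finset.sum_ite_eq, Finset.mem_univ, if_true, Finset.mul_sum]
  exact Finset.sum_congr rfl fun n _ => by ring

/-- The ray amplitude is a continuous function of the record. [folklore] -/
theorem continuous_rayAmplitude_sphere (L : ℝ) (S : Finset (Fin 3 → ℤ)) (φ : Space → ℂ) :
    Continuous fun z : ↥(sphere (0 : EuclideanSpace ℂ ↥S) 1) =>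
      rayAmplitude L S (z : EuclideanSpace ℂ ↥S) φ := by
  unfold rayAmplitude
  exact continuous_finsetSum _ fun n _ =>
    (Complex.continuous_conj.comp (continuous_sphere_coord n)).mul continuous_const

/-- The ray amplitude is bounded on the sphere: `|b_z| ≤ ∑_n |a_n|`. [folklore] -/
theorem norm_rayAmplitude_le (L : ℝ) (S : Finset (Fin 3 → ℤ)) (φ : Space → ℂ)
    (z : ↥(sphere (0 : EuclideanSpace ℂ ↥S) 1)) :
    ‖rayAmplitude L S (z : EuclideanSpace ℂ ↥S) φ‖ ≤ ∑ n : ↥S, ‖modeCoeff L n φ‖ := by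
  unfold rayAmplitude
  refine (norm_sum_le _ _).trans (Finset.sum_le_sum fun n _ => ?_)
  rw [norm_mul, Complex.norm_conj]
  exact mul_le_of_le_one_left (norm_nonneg _) (norm_sphere_coord_le_one z n)

/-- **The coarse-mode ray POVM on one particle: `∫ ‖K_zΦ‖² dσ(z) = ‖Φ‖²`.** For `L > 0`,
`S ≠ ∅` and a continuous one-particle function `Φ`, the weights of the records integrate to the
norm: `∫_{S^{2M-1}} (∫_{cell} |K_zΦ|²) dσ(z) = ∫_{cell} |Φ|²`. This is the `m ≤ 1` part of the
resolution of the identity behind `coarseModeRayPOVM` (`K_z = (𝟙 - P_S) + √M P_z` on one particle,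
`c_0 = 1`, `c_1 = M`): `‖K_zΦ‖² = ‖φ - P_Sφ‖² + M|⟨ψ_z,φ⟩|²`, `M∫|⟨ψ_z,φ⟩|²dσ = ∑_{n∈S}|a_n|²`
and Bessel's identity `‖φ - P_Sφ‖² = ‖φ‖² - ∑|a_n|²`. [cite: BengtssonZyczkowski2017, §7.5 (7.59)] -/
theorem integral_rayMeasure_integral_norm_sq_coarseModeRayPOVM_one (hL : 0 < L) (hS : S.Nonempty)
    {Φ : Config 1 → ℂ} (hΦ : Continuous Φ) :
    ∫ z, (∫ X in cellN 1 L, ‖coarseModeRayPOVM L S (z : EuclideanSpace ℂ ↥S) Φ X‖ ^ 2)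
        ∂rayMeasure S = ∫ X in cellN 1 L, ‖Φ X‖ ^ 2 := by
  haveI := isProbabilityMeasure_rayMeasure hS
  set φ := oneBodyOf Φ with hφdef
  have hφ : Continuous φ := continuous_oneBodyOf hΦ
  set Q : ℂ := cellInner L (φ - coarsePart L S φ) (φ - coarsePart L S φ) with hQ
  have hM : (S.card : ℂ) ≠ 0 := Nat.cast_ne_zero.mpr hS.card_pos.ne'
  -- integrability of `z ↦ conj(b_z) b_z`
  have hbint : Integrable (fun z : ↥(sphere (0 : EuclideanSpace ℂ ↥S) 1) =>
      conj (rayAmplitude L S (z : EuclideanSpace ℂ ↥S) φ) *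
        rayAmplitude L S (z : EuclideanSpace ℂ ↥S) φ) (rayMeasure S) := by
    refine integrable_rayMeasure_of_norm_le
      ((Complex.continuous_conj.comp (continuous_rayAmplitude_sphere L S φ)).mul
        (continuous_rayAmplitude_sphere L S φ)) (C := (∑ n : ↥S, ‖modeCoeff L n φ‖) ^ 2) fun z => ?_
    rw [norm_mul, Complex.norm_conj, sq]
    exact mul_le_mul (norm_rayAmplitude_le L S φ z) (norm_rayAmplitude_le L S φ z) (norm_nonneg _)
      (Finset.sum_nonneg fun n _ => norm_nonneg _)
  -- the computation, in `ℂ`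
  apply Complex.ofReal_injective
  rw [← integral_complex_ofReal]
  have hz : ∀ z : ↥(sphere (0 : EuclideanSpace ℂ ↥S) 1),
      ((∫ X in cellN 1 L, ‖coarseModeRayPOVM L S (z : EuclideanSpace ℂ ↥S) Φ X‖ ^ 2 : ℝ) : ℂ) =
        Q + (S.card : ℂ) * (conj (rayAmplitude L S (z : EuclideanSpace ℂ ↥S) φ) *
          rayAmplitude L S (z : EuclideanSpace ℂ ↥S) φ) :=
    fun z => integral_norm_sq_coarseModeRayPOVM_one hL S z hΦ
  simp_rw [hz]
  rw [integral_add (integrable_const Q) (hbint.const_mul _), integral_const, integral_const_mul,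
    integral_conj_rayAmplitude_mul_rayAmplitude hS L φ]
  simp only [probReal_univ, one_smul]
  rw [← mul_assoc, mul_inv_cancel₀ hM, one_mul, hQ, cellInner_sub_coarsePart_self hL S hφ,
    ← Finset.sum_coe_sort S (fun n => conj (modeCoeff L n φ) * modeCoeff L n φ), sub_add_cancel,
    cellInner_self_eq_ofReal, ← integral_cellN_one L (fun x => ‖φ x‖ ^ 2)]
  simp only [hφdef, oneBodyOf_apply_zero]

/-- **The POVM identity on one particle, `ℝ≥0∞` form**:
`∫⁻ (∫⁻_{cell} ‖K_zΦ‖₊²) dσ(z) = ∫⁻_{cell} ‖Φ‖₊²` (so `= 1` for a normalised one-particle state).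
[cite: BengtssonZyczkowski2017, §7.5 (7.59)] -/
theorem lintegral_rayMeasure_lintegral_nnnorm_sq_coarseModeRayPOVM_one (hL : 0 < L)
    (hS : S.Nonempty) {Φ : Config 1 → ℂ} (hΦ : Continuous Φ) :
    ∫⁻ z, (∫⁻ X in cellN 1 L, (‖coarseModeRayPOVM L S (z : EuclideanSpace ℂ ↥S) Φ X‖₊ : ℝ≥0∞) ^ 2)
        ∂rayMeasure S = ∫⁻ X in cellN 1 L, (‖Φ X‖₊ : ℝ≥0∞) ^ 2 := by
  haveI := isProbabilityMeasure_rayMeasure hS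
  have hmain := integral_rayMeasure_integral_norm_sq_coarseModeRayPOVM_one hL hS hΦ
  set φ := oneBodyOf Φ with hφdef
  have hφ : Continuous φ := continuous_oneBodyOf hΦ
  -- continuity of `X ↦ K_zΦ X` on one particle, from the mode decomposition
  have hKc : ∀ z : EuclideanSpace ℂ ↥S, Continuous fun X : Config 1 => coarseModeRayPOVM L S z Φ X := by
    intro z
    have h : (fun X : Config 1 => coarseModeRayPOVM L S z Φ X) = fun X =>
        (φ - coarsePart L S φ) (X 0) +
          ((Real.sqrt S.card : ℂ) * rayAmplitude L S z φ) * rayMode L S z (X 0) :=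
      funext fun X => coarseModeRayPOVM_one_eq_fine_add_ray L S z hΦ X
    rw [h]
    exact ((hφ.sub (continuous_coarsePart L S φ)).comp (continuous_apply 0)).add
      (continuous_const.mul ((continuous_rayMode L S z).comp (continuous_apply 0)))
  have hKint : ∀ z : EuclideanSpace ℂ ↥S, Integrable (fun X : Config 1 => ‖coarseModeRayPOVM L S z Φ X‖ ^ 2)
      ((volume : Measure (Config 1)).restrict (cellN 1 L)) := fun z =>
    integrableOn_cellN (((hKc z).norm).pow 2) L
  have hinner : ∀ z : ↥(sphere (0 : EuclideanSpace ℂ ↥S) 1),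
      ∫⁻ X in cellN 1 L, (‖coarseModeRayPOVM L S (z : EuclideanSpace ℂ ↥S) Φ X‖₊ : ℝ≥0∞) ^ 2 =
        ENNReal.ofReal (∫ X in cellN 1 L, ‖coarseModeRayPOVM L S (z : EuclideanSpace ℂ ↥S) Φ X‖ ^ 2) := by
    intro z
    rw [ofReal_integral_eq_lintegral_ofReal (hKint _)
      (Filter.Eventually.of_forall fun X => sq_nonneg _)]
    exact lintegral_congr fun X => coe_nnnorm_sq_eq_ofReal _
  have hΦint : Integrable (fun X : Config 1 => ‖Φ X‖ ^ 2)
      ((volume : Measure (Config 1)).restrict (cellN 1 L)) :=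
    integrableOn_cellN ((hΦ.norm).pow 2) L
  have hΦinner : ∫⁻ X in cellN 1 L, (‖Φ X‖₊ : ℝ≥0∞) ^ 2 =
      ENNReal.ofReal (∫ X in cellN 1 L, ‖Φ X‖ ^ 2) := by
    rw [ofReal_integral_eq_lintegral_ofReal hΦint (Filter.Eventually.of_forall fun X => sq_nonneg _)]
    exact lintegral_congr fun X => coe_nnnorm_sq_eq_ofReal _
  -- integrability of the weight as a function of the record (it is `Re(Q + M conj(b_z) b_z)`)
  have hbint : Integrable (fun z : ↥(sphere (0 : EuclideanSpace ℂ ↥S) 1) =>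
      conj (rayAmplitude L S (z : EuclideanSpace ℂ ↥S) φ) *
        rayAmplitude L S (z : EuclideanSpace ℂ ↥S) φ) (rayMeasure S) := by
    refine integrable_rayMeasure_of_norm_le
      ((Complex.continuous_conj.comp (continuous_rayAmplitude_sphere L S φ)).mul
        (continuous_rayAmplitude_sphere L S φ)) (C := (∑ n : ↥S, ‖modeCoeff L n φ‖) ^ 2) fun z => ?_
    rw [norm_mul, Complex.norm_conj, sq]
    exact mul_le_mul (norm_rayAmplitude_le L S φ z) (norm_rayAmplitude_le L S φ z) (norm_nonneg _)
      (Finset.sum_nonneg fun n _ => norm_nonneg _)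
  have hfint : Integrable (fun z : ↥(sphere (0 : EuclideanSpace ℂ ↥S) 1) =>
      ∫ X in cellN 1 L, ‖coarseModeRayPOVM L S (z : EuclideanSpace ℂ ↥S) Φ X‖ ^ 2) (rayMeasure S) := by
    have hg : Integrable (fun z : ↥(sphere (0 : EuclideanSpace ℂ ↥S) 1) =>
        RCLike.re (cellInner L (φ - coarsePart L S φ) (φ - coarsePart L S φ) +
          (S.card : ℂ) * (conj (rayAmplitude L S (z : EuclideanSpace ℂ ↥S) φ) *
            rayAmplitude L S (z : EuclideanSpace ℂ ↥S) φ))) (rayMeasure S) :=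
      ((integrable_const _).add (hbint.const_mul _)).re
    refine hg.congr (Filter.Eventually.of_forall fun z => ?_)
    have h := congrArg Complex.re (integral_norm_sq_coarseModeRayPOVM_one hL S z hΦ)
    rw [Complex.ofReal_re] at h
    exact h.symm
  simp_rw [hinner]
  rw [hΦinner, ← hmain, ofReal_integral_eq_lintegral_ofReal hfint
    (Filter.Eventually.of_forall fun z => integral_nonneg fun X => sq_nonneg _)]

end Literature.MathematicalPhysics.QuantumManyBody.BoseGas
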